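import Literature.AlgebraicTopology.SingularHomology.RelativeKronecker
import Literature.AlgebraicTopology.SingularHomology.UniversalCoefficientsProofs
import HarnessLib

/-!
# The relative Kronecker pairing against absolute classes: `⟨j^* x, c⟩ = ⟨x, j_* c⟩`

A. Hatcher, *Algebraic Topology* (2002), §3.1 p. 200 (the map `j^* : Hⁿ(X, A; G) → Hⁿ(X; G)`
induced by the inclusion of the relative cochains, "functions vanishing on simplices in `A`") and
p. 191 / pp. 199–201 (the Kronecker pairing `⟨[φ], [z]⟩ = φ(z)` of a pair, natural in maps of
pairs).  For the pair map `j : (X, ∅) → (X, A)` naturality reads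

  `⟨j^* x, c⟩ = ⟨x, j_* c⟩`  for `x ∈ Hᵐ(X, A; R)`, `c ∈ Hₘ(X; R)`,

with `j^* = relSingularCohomology.toAbsolute` and `j_* = relativeSingularHomology.ofAbsolute`.
In the tree the two sides live on different models — the absolute pairing `kroneckerPairing`
(`CapProduct.lean`, `ε(a ⌢ c)` on Mathlib's singular chains) and the relative pairing
`relKroneckerM` (`RelativeKronecker.lean`, evaluation of function cochains on the concrete
quotient complex `C(X)/C(A)`, transported to `relativeSingularHomology` by `concreteIso`) — and
this file proves the identity between them (`kroneckerPairing_toAbsolute`): both sides are the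
value `φ(z)` of a representing relative cocycle `φ` on a representing cycle `z`
(`kroneckerPairing_π_homologyπ`, `relKronecker_π_relClsₗ`, `ofAbsolute_comp_concreteIso_hom`).

Everything is proved; no definitions, no named facts.

## References

* [HatcherAT2002] A. Hatcher, Algebraic Topology, CUP 2002, §3.1 pp. 191, 199–201.
-/

set_option backward.isDefEq.respectTransparency false

noncomputable section

open CategoryTheory Limits

universe u v

namespace Literature.AlgebraicTopology.SingularHomology

variable {R : Type v} [CommRing R] {X : Type u} [TopologicalSpace X]

open singularCochainComplex relCochainComplex

/-- The inverse of the homology comparison isomorphism is `Hₘ` of the inverse chain comparison.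
[folklore] -/
theorem csingularHomology.compIso_inv_eq (m : ℕ) :
    (csingularHomology.compIso R R X m).inv =
      HomologicalComplex.homologyMap (csingularChainComplex.compIso R R X).inv m := rfl

/-- The inverse chain comparison in degree `m` is `compInv`. [folklore] -/
theorem csingularChainComplex.compIso_inv_f (m : ℕ) :
    (csingularChainComplex.compIso R R X).inv.f m = csingularChainComplex.compInv R R X m := rfl

/-- **`⟨j^* x, c⟩ = ⟨x, j_* c⟩`**: the absolute Kronecker pairing of the image of a relative class
`x ∈ Hᵐ(X, A; R)` in `Hᵐ(X; R)` with `c ∈ Hₘ(X; R)` is the relative Kronecker pairing of `x` with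
the image `j_* c ∈ Hₘ(X, A; R)` (Hatcher 2002, §3.1 p. 200–201: naturality of `⟨ , ⟩` for the map
of pairs `(X, ∅) → (X, A)`; both are `φ(z)` on representatives). [cite: HatcherAT2002, §3.1 pp. 199–201] -/
theorem kroneckerPairing_toAbsolute (A : Set X) (m : ℕ) (x : relSingularCohomology R R X A m)
    (c : singularHomology R R X m) :
    kroneckerPairing R R X m (relSingularCohomology.toAbsolute R R X A m x) c =
      relKroneckerM R X A m x (relativeSingularHomology.ofAbsolute R R X A m c) := by
  -- representatives: `x = [z]`, `c = [ζ]`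
  obtain ⟨z, rfl⟩ := (ModuleCat.epi_iff_surjective _).1
    (inferInstance : Epi ((relCochainComplex R R A).homologyπ m)) x
  induction c using singularHomology_induction_on with
  | h ζ =>
  -- left-hand side: `j^* [z] = [ι z]`, paired with `[ζ]` gives `(val z)(ζ)`
  have hL : relSingularCohomology.toAbsolute R R X A m ((relCochainComplex R R A).homologyπ m z) =
      singularCohomology.π R R X m (HomologicalComplex.cyclesMap (ι R R A) m z) := by
    change ((relCochainComplex R R A).homologyπ m ≫ HomologicalComplex.homologyMap (ι R R A) m) z = _
    rw [HomologicalComplex.homologyπ_naturality]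
    rfl
  have hι : iCocycles R R X m (HomologicalComplex.cyclesMap (ι R R A) m z) =
      val ((relCochainComplex R R A).iCycles m z) := by
    change ((HomologicalComplex.cyclesMap (ι R R A) m) ≫ (singularCochainComplex R R X).iCycles m) z = _
    rw [HomologicalComplex.cyclesMap_i]
    rfl
  rw [hL, kroneckerPairing_π_homologyπ, LinearMap.comp_apply, hι]
  -- right-hand side: `j_* [ζ]` in the concrete model is the relative class of `w = compInv ζ`
  set w : (csingularChainComplex R R X).X m :=
    (csingularChainComplex.compIso R R X).inv.f m (singularChainComplex.iCycles R R X m ζ) with hw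
  have hζ : (singularChainComplex R R X).d m ((ComplexShape.down ℕ).next m)
      (singularChainComplex.iCycles R R X m ζ) = 0 := by
    rw [← ModuleCat.comp_apply, HomologicalComplex.iCycles_d]
    rfl
  have hdw : (csingularChainComplex R R X).d m ((ComplexShape.down ℕ).next m) w = 0 := by
    rw [hw, ← ModuleCat.comp_apply, (csingularChainComplex.compIso R R X).inv.comm, ModuleCat.comp_apply,
      hζ, map_zero]
  have hwZ : (w : CChain R X m) ∈ relZ R A m := by
    rw [mem_relZ_iff]
    rw [hdw]
    exact Submodule.zero_mem _
  have hfac : relativeSingularHomology.ofAbsolute R R X A m =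
      ((csingularHomology.compIso R R X m).inv ≫ HomologicalComplex.homologyMap (chainsInSub R R X A).π m) ≫
        (relativeSingularHomology.concreteIso R R X A m).inv :=
    (Iso.eq_comp_inv _).2 (relativeSingularHomology.ofAbsolute_comp_concreteIso_hom R R A m)
  -- `H(compIso⁻¹) [ζ] = [w]`
  have h1 : HomologicalComplex.homologyMap (csingularChainComplex.compIso R R X).inv m
      ((singularChainComplex R R X).homologyπ m ζ) = homologyCls w hdw := by
    have e' : HomologicalComplex.homologyMap (csingularChainComplex.compIso R R X).inv m
        ((singularChainComplex R R X).homologyπ m ζ) =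
        (csingularChainComplex R R X).homologyπ m
          (HomologicalComplex.cyclesMap (csingularChainComplex.compIso R R X).inv m ζ) := by
      change ((singularChainComplex R R X).homologyπ m ≫
        HomologicalComplex.homologyMap (csingularChainComplex.compIso R R X).inv m) ζ = _
      rw [HomologicalComplex.homologyπ_naturality]
      rfl
    rw [e', homologyCls_eq_homologyπ_cyclesMk w hdw _ rfl hdw]
    congr 1
    apply (ModuleCat.mono_iff_injective ((csingularChainComplex R R X).iCycles m)).1 inferInstance
    symm
    refine ((csingularChainComplex R R X).i_cyclesMk _ _ _ _).trans ?_
    change w = ((HomologicalComplex.cyclesMap (csingularChainComplex.compIso R R X).inv m) ≫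
      (csingularChainComplex R R X).iCycles m) ζ
    rw [HomologicalComplex.cyclesMap_i]
    rfl
  have hR : relativeSingularHomology.ofAbsolute R R X A m ((singularChainComplex R R X).homologyπ m ζ) =
      (relativeSingularHomology.concreteIso R R X A m).inv (relClsₗ R A m ⟨w, hwZ⟩) := by
    rw [hfac, ModuleCat.comp_apply, ModuleCat.comp_apply, csingularHomology.compIso_inv_eq, h1,
      Subcomplex.homologyMap_π_homologyCls _ w hdw ((mem_relZ_iff _).1 hwZ)]
    rfl
  rw [hR, relKroneckerM_apply, Iso.inv_hom_id_apply]
  exact (relKronecker_π_relClsₗ R z ⟨w, hwZ⟩).symm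

end Literature.AlgebraicTopology.SingularHomology
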